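import Summits.BirchSwinnertonDyer.Rank1Residual.X11b.TransvectionStableLine
import HarnessLib

/-!
# Irreducible + a transvection ⟹ absolutely irreducible, also on every subgroup of index two

HONEST FRAMING (cell `b2b-bsdres`, run/shared/lean/b2b/bsd-rank1-residual/, verbatim in every
file): the goal of the cell is to DELETE the COMBINATION-SHAPED residual classes of the
Birch–Swinnerton-Dyer formula for ALL analytic-rank `≤ 1` elliptic curves over `ℚ` — "full BSD
formula for every rank `≤ 1` curve in class `C`" assembled STRICTLY from published theorems — so
that the rank-`≤ 1` remainder becomes exactly the CONSTRUCTION-SHAPED classes, which are TYPED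
(missing-input `Prop`s), NOT attempted. This is not "finishing BSD". Sub-cell
`b2b-bsdres-multr1-p1` (X11b, route R1); no claim beyond the stated class; X11b stays
CONSTRUCTION-SHAPED; nothing here changes a label; no named fact (theorems only; no `sorry`).

## What this file kernel-checks, and why

[FW21, Thm. 4.41] (the one unrefereed atom of routes R1/p2 on `Locus`, see
`CongruenceLimitOneSided.lean`) and [Cas20, Thm. A] ask for "`ρ̄|_{G_K}` ABSOLUTELY irreducible",
while the erratum's Thm. 1.1 (i) / Thm. 2.3 (i) say "irreducible" (footnote 1: from `E[p]`
irreducible and ramified at `q ∥ N` via [Ski20, Lem. 2.8.1]). This file proves the elementary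
group theory closing that wording gap on the cell's loci (`Irr ∧ Ram`, `p` odd), in the tree's
vocabulary `FramedRep` / `FramedRep.IsAbsolutelyIrreducible` (`ContinuousRep.lean`):

* `isAbsolutelyIrreducible_of_transvection` — **`ρ : G → GL₂(A)` irreducible over the field `A`
  with a transvection `ρ(g₀)` in its image is absolutely irreducible** (over `B ⊇ A` a stable line
  is `ker(ρ(g₀) − 1)`, defined over `A`, where it would be stable);
* `IsAbsolutelyIrreducible.comp_of_index_two_of_transvection` — absolutely irreducible +
  transvection + `char A ≠ 2` ⟹ absolutely irreducible on every subgroup of index `2`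
  (`Transvection.isIrreducible_comp_of_index_two_of_transvection` of `TransvectionStableLine.lean`
  after base change; false for `𝔽₂`: `GL₂(𝔽₂) ≅ S₃ ⊃ A₃`);
* `isAbsolutelyIrreducible_comp_of_index_two_of_transvection` — the combination: irreducible +
  transvection + `char ≠ 2` ⟹ absolutely irreducible on every index-`2` subgroup.

Dictionary: `A = 𝔽_p` (`p` odd), `ρ = ρ̄_{E,p}` framed, `G = G_ℚ`, `H = G_K` for a quadratic
`K` (index `2`: tree `Automorphic.isOpen_range_absGaloisRestrict_and_index`), `g₀` a generator of
tame inertia at a multiplicative prime `q` with `p ∤ v_q(Δ)` — the Tate curve gives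
`ρ̄(g₀) = (1 1; 0 1)` in a suitable basis (this identification of the census predicate `Ram` with
a transvection is Serre/Tate, [cite-level input, not re-proved here]). Companion of the tree's
`AbsIrreducibleIndexTwo.lean` (odd dimension / Clifford), which does not cover dimension `2`.

References: J.-P. Serre, *Propriétés galoisiennes des points d'ordre fini des courbes
elliptiques*, Invent. Math. 15 (1972) §2.8 (transvections) [Serre1972]; [FouquetWan2021] Thm.
4.41; [Castella2018Erratum] Thm. 1.1 (i), footnote 1.
-/

noncomputable section

namespace Summit.BirchSwinnertonDyer.Rank1Residual.X11b.Transvection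

universe u

/-! ### Framed representations of rank two: absolute irreducibility from a transvection -/

section Framed

open Literature Literature.NumberTheory.GaloisRepresentations

variable {G : Type*} [Group G] [TopologicalSpace G] {H : Type*} [Group H] [TopologicalSpace H]
  {A : Type u} [Field A] [TopologicalSpace A]

/-- The transvection survives base change: for `ρ(g₀) = P` with `P ≠ 1`, `(P − 1)² = 0` and a ring
map `f : A → B` of fields, the base-changed `ρ_B(g₀)` is `1 + N_B` with `N_B ≠ 0`, `N_B² = 0`,
where `N_B = (P − 1)^f` acting on `B²`, and `N_B (f ∘ v) = f ∘ ((P − 1)v)`. [folklore] -/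
theorem exists_transvection_baseChange (ρ : FramedRep G A 2) (g₀ : G)
    (hne : ((ρ g₀ : GL (Fin 2) A) : Matrix (Fin 2) (Fin 2) A) ≠ 1)
    (hsq : (((ρ g₀ : GL (Fin 2) A) : Matrix (Fin 2) (Fin 2) A) - 1) *
      (((ρ g₀ : GL (Fin 2) A) : Matrix (Fin 2) (Fin 2) A) - 1) = 0)
    (B : Type u) [Field B] (f : A →+* B) :
    ∃ NB : (Fin 2 → B) →ₗ[B] (Fin 2 → B),
      ρ.baseChangeRepresentation f g₀ = 1 + NB ∧ NB ≠ 0 ∧ NB ∘ₗ NB = 0 ∧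
        ∀ v : Fin 2 → A, NB (f ∘ v) =
          f ∘ ((((ρ g₀ : GL (Fin 2) A) : Matrix (Fin 2) (Fin 2) A) - 1).mulVec v) := by
  classical
  set P : Matrix (Fin 2) (Fin 2) A := ((ρ g₀ : GL (Fin 2) A) : Matrix (Fin 2) (Fin 2) A) with hP
  refine ⟨Matrix.toLin' ((P - 1).map f), ?_, ?_, ?_, ?_⟩
  · apply LinearMap.ext
    intro v
    rw [FramedRep.baseChangeRepresentation_apply_apply, LinearMap.add_apply, Module.End.one_apply,
      Matrix.toLin'_apply]
    have hcoe : ((Matrix.GeneralLinearGroup.map f (ρ g₀) : GL (Fin 2) B) : Matrix (Fin 2) (Fin 2) B)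
        = P.map f := rfl
    rw [hcoe, show P.map f = (P - 1).map f + 1 by
      rw [Matrix.map_sub f (map_sub f), Matrix.map_one f (map_zero f) (map_one f), sub_add_cancel],
      Matrix.add_mulVec, Matrix.one_mulVec, add_comm]
  · intro h0
    apply hne
    have h1 : (P - 1).map f = 0 := by
      have := congrArg (fun L : (Fin 2 → B) →ₗ[B] (Fin 2 → B) => LinearMap.toMatrix' L) h0
      simpa using this
    have h2 : P - 1 = 0 := by
      ext i j
      have := congrFun (congrFun h1 i) j
      simp only [Matrix.map_apply, Matrix.zero_apply] at this
      rw [Matrix.zero_apply]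
      exact f.injective (by rw [this, map_zero])
    exact sub_eq_zero.1 h2
  · rw [← Matrix.toLin'_mul, ← Matrix.map_mul, hsq]
    simp
  · intro v
    rw [Matrix.toLin'_apply]
    exact (funext fun i => RingHom.map_mulVec f (P - 1) v i).symm

/-- **Irreducible with a transvection in the image ⟹ absolutely irreducible** (rank `2`, any
field `A`). If `ρ : G → GL₂(A)` is irreducible over `A` and some `ρ(g₀)` is a transvection
(`ρ(g₀) ≠ 1`, `(ρ(g₀) − 1)² = 0`), then `ρ` is absolutely irreducible: over any `B ⊇ A` a stable
line must be `ker(ρ(g₀) − 1)`, which is defined over `A` and would then be stable there.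
Dictionary: `ρ = ρ̄_{E,p}` (`A = 𝔽_p`), `g₀` a generator of tame inertia at a multiplicative prime
`q` with `p ∤ v_q(Δ_E)` (`E[p]` ramified at `q`: the Tate curve gives `ρ̄(g₀) = (1 *; 0 1) ≠ 1`).
[folklore] -/
theorem isAbsolutelyIrreducible_of_transvection (ρ : FramedRep G A 2) (hirr : ρ.IsIrreducible)
    (g₀ : G) (hne : ((ρ g₀ : GL (Fin 2) A) : Matrix (Fin 2) (Fin 2) A) ≠ 1)
    (hsq : (((ρ g₀ : GL (Fin 2) A) : Matrix (Fin 2) (Fin 2) A) - 1) *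
      (((ρ g₀ : GL (Fin 2) A) : Matrix (Fin 2) (Fin 2) A) - 1) = 0) :
    ρ.IsAbsolutelyIrreducible := by
  intro B _ f
  classical
  obtain ⟨NB, hπg, hNB, hNBsq, hNBv⟩ := exists_transvection_baseChange ρ g₀ hne hsq B f
  set π := ρ.baseChangeRepresentation f with hπdef
  set P : Matrix (Fin 2) (Fin 2) A := ((ρ g₀ : GL (Fin 2) A) : Matrix (Fin 2) (Fin 2) A) with hP
  have h2 : Module.finrank B (Fin 2 → B) = 2 := by simp
  -- nontriviality of the lattice of subrepresentations (`B² ≠ 0`)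
  have hVbt : (⊥ : Submodule B (Fin 2 → B)) ≠ ⊤ := by
    intro h
    have : (fun _ => (1 : B)) ∈ (⊥ : Submodule B (Fin 2 → B)) := by rw [h]; trivial
    rw [Submodule.mem_bot] at this
    exact one_ne_zero (congrFun this 0)
  haveI : Nontrivial (Subrepresentation π) :=
    ⟨⟨⊥, ⊤, fun h => hVbt (congrArg Subrepresentation.toSubmodule h)⟩⟩
  refine ⟨fun W => ?_⟩
  by_contra hW
  obtain ⟨hWb, hWt⟩ := not_or.mp hW
  have hUker : W.toSubmodule = LinearMap.ker NB :=
    toSubmodule_eq_ker_of_transvection π h2 hπg hNB hNBsq W hWb hWt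
  -- descend the kernel to `A`
  let N₀ : (Fin 2 → A) →ₗ[A] (Fin 2 → A) := Matrix.toLin' (P - 1)
  let ι : (Fin 2 → A) → (Fin 2 → B) := fun v => f ∘ v
  have hιinj : Function.Injective ι := fun v w h => funext fun i => f.injective (congrFun h i)
  have hι0 : ι 0 = 0 := funext fun _ => map_zero f
  have hιρ : ∀ (h : G) (v : Fin 2 → A), ι (ρ.toRepresentation h v) = π h (ι v) := by
    intro h v
    rw [FramedRep.toRepresentation_apply_apply, FramedRep.baseChangeRepresentation_apply_apply]
    exact funext fun i => RingHom.map_mulVec f _ v i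
  have hN₀ι : ∀ v : Fin 2 → A, NB (ι v) = ι (N₀ v) := fun v => by
    rw [hNBv v, Matrix.toLin'_apply]
  have hstab : ∀ (h : G), ∀ v ∈ LinearMap.ker N₀, ρ.toRepresentation h v ∈ LinearMap.ker N₀ := by
    intro h v hv
    rw [LinearMap.mem_ker] at hv ⊢
    apply hιinj
    rw [hι0, ← hN₀ι, hιρ]
    have hmem : ι v ∈ W.toSubmodule := by
      rw [hUker, LinearMap.mem_ker, hN₀ι, hv, hι0]
    have := W.apply_mem_toSubmodule h hmem
    rw [hUker, LinearMap.mem_ker] at this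
    exact this
  let K₀ : Subrepresentation ρ.toRepresentation := ⟨LinearMap.ker N₀, fun h v hv => hstab h v hv⟩
  have hN₀ne : N₀ ≠ 0 := by
    intro h0
    apply hne
    have : P - 1 = 0 := by
      have := congrArg (fun L : (Fin 2 → A) →ₗ[A] (Fin 2 → A) => LinearMap.toMatrix' L) h0
      simpa [N₀] using this
    exact sub_eq_zero.1 this
  have hN₀sq : N₀ ∘ₗ N₀ = 0 := by
    change Matrix.toLin' (P - 1) ∘ₗ Matrix.toLin' (P - 1) = 0
    rw [← Matrix.toLin'_mul, hsq]; simp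
  haveI := hirr
  rcases IsSimpleOrder.eq_bot_or_eq_top K₀ with h | h
  · exact ker_ne_bot_of_sq_eq_zero hN₀ne hN₀sq (congrArg Subrepresentation.toSubmodule h)
  · exact ker_ne_top_of_ne_zero hN₀ne (congrArg Subrepresentation.toSubmodule h)

/-- **Absolutely irreducible with a transvection ⟹ absolutely irreducible on every subgroup of
index two** (rank `2`, characteristic of `A` not `2`). Dictionary: `H = G_K ≤ G = G_ℚ` for a
quadratic field `K` (index `2`, tree `Automorphic.isOpen_range_absGaloisRestrict_and_index`),
`A = 𝔽_p`, `p` odd: the hypothesis "`ρ̄_f|_{G_K}` absolutely irreducible" of [FW21, Thm. 4.41] /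
[Cas20] for `ρ̄ = E[p]`, `E[p]` irreducible and ramified at a multiplicative prime. [folklore] -/
theorem IsAbsolutelyIrreducible.comp_of_index_two_of_transvection (ρ : FramedRep G A 2)
    (habs : ρ.IsAbsolutelyIrreducible) (h2A : (2 : A) ≠ 0) (g₀ : G)
    (hne : ((ρ g₀ : GL (Fin 2) A) : Matrix (Fin 2) (Fin 2) A) ≠ 1)
    (hsq : (((ρ g₀ : GL (Fin 2) A) : Matrix (Fin 2) (Fin 2) A) - 1) *
      (((ρ g₀ : GL (Fin 2) A) : Matrix (Fin 2) (Fin 2) A) - 1) = 0)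
    (φ : H →ₜ* G) (hφ : φ.toMonoidHom.range.index = 2) :
    FramedRep.IsAbsolutelyIrreducible (ρ.comp φ) := by
  intro B _ f
  classical
  rw [FramedRep.baseChangeRepresentation_comp]
  obtain ⟨NB, hπg, hNB, hNBsq, -⟩ := exists_transvection_baseChange ρ g₀ hne hsq B f
  have h2 : Module.finrank B (Fin 2 → B) = 2 := by simp
  have hcharB : (2 : B) ≠ 0 := by
    intro h
    apply h2A
    apply f.injective
    rw [map_ofNat, map_zero, h]
  exact isIrreducible_comp_of_index_two_of_transvection _ h2 hcharB (habs B f) hπg hNB hNBsq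
    φ.toMonoidHom hφ

/-- **Irreducible with a transvection, characteristic `≠ 2` ⟹ absolutely irreducible on every
subgroup of index two.** The form used on route R1/p2's loci: `E[p]` irreducible (`p` odd) and
ramified at a multiplicative prime `q` (census predicate `Ram`) ⟹ `E[p]|_{G_K}` absolutely
irreducible for every quadratic `K` — the wording of [FW21, Thm. 4.41] bullet 1 versus the
erratum's Thm. 1.1 (i) / footnote 1. [folklore] -/
theorem isAbsolutelyIrreducible_comp_of_index_two_of_transvection (ρ : FramedRep G A 2)
    (hirr : ρ.IsIrreducible) (h2A : (2 : A) ≠ 0) (g₀ : G)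
    (hne : ((ρ g₀ : GL (Fin 2) A) : Matrix (Fin 2) (Fin 2) A) ≠ 1)
    (hsq : (((ρ g₀ : GL (Fin 2) A) : Matrix (Fin 2) (Fin 2) A) - 1) *
      (((ρ g₀ : GL (Fin 2) A) : Matrix (Fin 2) (Fin 2) A) - 1) = 0)
    (φ : H →ₜ* G) (hφ : φ.toMonoidHom.range.index = 2) :
    FramedRep.IsAbsolutelyIrreducible (ρ.comp φ) :=
  IsAbsolutelyIrreducible.comp_of_index_two_of_transvection ρ
    (isAbsolutelyIrreducible_of_transvection ρ hirr g₀ hne hsq) h2A g₀ hne hsq φ hφ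

end Framed

end Summit.BirchSwinnertonDyer.Rank1Residual.X11b.Transvection

end
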